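/-
Copyright: derived here (Resolution Observatory cell `pub-rosobs`, carver gen 61). AI-written Lean; AI review is
weaker than expert review.  Companion file of the cell's POLYNOMIAL weighted-centre model `W(f)` (engine 1's `W(f)` /
(P)-system TOY MODEL; THEOREM-F-eng1-g40 §4b "second proof of THEOREM F via LEMMA XL", CARVER-NOTES-eng1-g40 T79).
Instrument — NOT a resolution theorem and NOT a statement about the invariant of [AbramovichTemkinWlodarczyk2024].
-/
import Literature.AlgebraicGeometry.Resolution.WeightedCentreLowestTaylor
import Literature.AlgebraicGeometry.Resolution.WeightedCentreTaylorShape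
import Literature.AlgebraicGeometry.Resolution.WeightedCentreClassLinearPin
import Literature.AlgebraicGeometry.Resolution.WeightedCentreTruncation
import Literature.AlgebraicGeometry.Resolution.WeightedCentreDerivationLayers
import Literature.AlgebraicGeometry.Resolution.WeightedCentreConstantField
import Mathlib.Algebra.Polynomial.Expand
import HarnessLib

/-!
# THEOREM F in LEMMA-XL normal form: a graded isotropy of degree `ρ₁` satisfying (P) is the identity

Setting (`WeightedCentreGradedIsotropy`, `WeightedCentreLowestTaylor`): `k` a PERFECT field of characteristic `p`,
`A₀ = k[ε_ι]` (`ι` finite) with rational weights `w`, `A₀[σ] = A₀[X]`, `deg σ = ρ > 0`; the WEIGHT FLOOR is `pρ`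
(every `w j ≥ pρ`; the floor class `T = {w = pρ}` = the `W`-slots), the `f`-CLASS is `S_f = {w = (p+1)ρ}`, and `g ∈ A₀` is
`w`-homogeneous of weight `μ = p(p+1)ρ` (THEOREM F: `ρ = ρ₁ = 1/(p(p+1))`, floor `1/(p+1)`, `f`-class `1/p`, `μ = 1`).
`Φ` is a GRADED ISOTROPY of `g` (`IsGradedIso w ρ g Φ`: graded, `Φ σ = σ`, `Φ(C g) = C g`) with `Φ ≡ id (mod σ)`
(`IsIdModSigma Φ`), in LEMMA-XL NORMAL FORM: `Φ` fixes every slot heavier than the `f`-class (`hV`), and WITHOUT PURE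
`W`-TERM (`pureCoeff Φ n p = 0` on the floor slots).  (P) enters as the class-linear pin condition of
`WeightedCentreClassLinearPin` for the TRUNCATION `P = killLight_{(p+1)ρ ≤ w} g` (the part of `g` in the slots of weight
`≥ 1/p`): `ClassPinned S_f P i` for every `i ∈ S_f`.

* **`IsGradedIso.eq_id_of_classPinned` (THEOREM F★ = T79, second proof, both leaves).**  Under these hypotheses `Φ = id`.
  Proof as in THEOREM-F-eng1-g40 §3–§4b, with STEP 4 INTRINSIC (no `f`-basis change):
  STEP 2 (`WeightedCentreTaylorShape`): `Φ` fixes `I` and `W`, and `Φ(C f_i) = C f_i + σ·C M_i + C(C d_i)σ^{p+1}` with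
  `M_i = Σ_{n ∈ T} c_{in} W_n`;  `E₁ = [σ¹](Φ − id)` is the derivation `D = Σ_{i ∈ S_f} M_i ∂_i` (`lowestDerivation`,
  `derivation_apply_eq_sum_pderiv_mul`) and `D g = 0`;  `D` has degree `−1` for the LIGHT-DEGREE grading (`ν = 1` off
  the heavy slots), so `D P = 0` for the light-degree-`0` component `P = killLight g` of `g`
  (`WeightedCentreDerivationLayers.mkDerivation_component_eq_zero`, `weightedHomogeneousComponent_lightDegree_zero`);
  STEP 4: `exists_rank_one_of_D_eq_zero_class` (perfect `k`, (P)): `c_{in} = v_i λ_n`, i.e. `M_i = v_i·Λ`, `Λ = Σ λ_n W_n`;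
  LEAF (b) (`Λ·v = 0`, pure translation `f_i ↦ f_i + σ^{p+1} d_i`): `Φ ∘ C = expand_{p+1} ∘ lineShift d`, so
  `g(f + t d) = g` (`isIsotropyOf_iff_of_expand`), `d` is an invariant direction of `g`, hence of `P`
  (`IsInvariantDir.killLight`) — contradicting (P) unless `d = 0`, i.e. `Φ = id`;
  LEAF (a) (`M_{i₁} ≠ 0`): `Φ(C a) ≡ a(f + σΛv) (mod σ^{p+1})` (`sub_aeval_mem_span_X_pow`) and
  `a(f + σΛv) = (lineShift v a)(σΛ)` (`aeval_eq_lineShift_comp`, `coeff_comp_X_mul_C`), so `Φ(C g) = C g` kills the Hasse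
  derivatives `[t^s] g(f + t v)`, `1 ≤ s ≤ p` (`Λ ≠ 0`, `A₀` a domain), while those with `s > p` vanish by weight
  (`isTW_lineShift`: `[t^s]` weighs `μ − s(p+1)ρ < 0`); so `v ≠ 0` is an invariant direction of `g`, hence of `P` — contradicting (P).
  No parity hypothesis on `p` is needed in this normal form.

What is NOT here: LEMMA XL itself (the reduction of an arbitrary (P)-system to this normal form, T78) and the induction over
the heavy classes; (P) is taken in its repaired class-linear form (`ClassPinned`), whose derivation from the slot form
`SlotPinned` of `WeightedCentreTruncation` is a separate bridge.

References: weighted blow-ups and their gradings [AbramovichTemkinWlodarczyk2024, §5.1 (p. 1575), Thm. 5.3.1 (2)–(3)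
(p. 1578)] (CONTEXT ONLY: the statement is engine 1's THEOREM F for its toy model, not a theorem of that paper); higher
derivations [Matsumura1987, §27, p. 207]; polynomial substitutions / invariant directions / Frobenius [Lang2002, Ch. IV §1,
Ch. V §6].  The formalisation and the intrinsic STEP 4 / LEAF (a) are ours.
-/

namespace Literature.AlgebraicGeometry.Resolution.WeightedBlowup

open Polynomial InvariantDirection

/-! ## Truncation plumbing: light variables, invariant directions, the light-degree grading -/

section KillLight

variable {K : Type*} [CommRing K] {ι : Type*} (H : ι → Prop) [DecidablePred H]

/-- A light variable does not occur in `killLight H G` (ours, bookkeeping). [cite: AbramovichTemkinWlodarczyk2024, §5.1 (p. 1575)] -/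
theorem notMem_vars_killLight [DecidableEq ι] (G : MvPolynomial ι K) {n : ι} (hn : ¬ H n) : n ∉ (killLight H G).vars := by
  intro h
  obtain ⟨t, ht, hnt⟩ := (MvPolynomial.mem_vars_iff_mem_support n).mp h
  have hc : MvPolynomial.coeff t (killLight H G) ≠ 0 := MvPolynomial.mem_support_iff.mp ht
  rw [coeff_killLight] at hc
  split_ifs at hc with hHt
  · exact hn (hHt n hnt)
  · exact hc rfl

/-- `killLight` commutes with the shift along a direction supported on the heavy slots:
`(killLight G)(X + t v) = killLight(G(X + t v))` coefficientwise (ours). [cite: Lang2002, Ch. IV §1] -/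
theorem InvariantDirection.lineShift_killLight (v : ι → K) (hv : ∀ j, ¬ H j → v j = 0) (G : MvPolynomial ι K) :
    lineShift v (killLight H G) =
      Polynomial.map (killLight (S := K) H : MvPolynomial ι K →+* MvPolynomial ι K) (lineShift v G) := by
  induction G using MvPolynomial.induction_on with
  | C c =>
    rw [MvPolynomial.algHom_C, MvPolynomial.algebraMap_eq, lineShift_C, Polynomial.map_C, RingHom.coe_coe,
      MvPolynomial.algHom_C, MvPolynomial.algebraMap_eq]
  | add a b ha hb => simp only [map_add, Polynomial.map_add, ha, hb]
  | mul_X a n ha =>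
    have hXn : lineShift v (killLight H (MvPolynomial.X n)) =
        Polynomial.map (killLight (S := K) H : MvPolynomial ι K →+* MvPolynomial ι K) (lineShift v (MvPolynomial.X n)) := by
      rw [killLight_X, lineShift_X, Polynomial.map_add, Polynomial.map_mul, Polynomial.map_C, Polynomial.map_X,
        Polynomial.map_C, RingHom.coe_coe, killLight_X, MvPolynomial.algHom_C, MvPolynomial.algebraMap_eq, heavyX]
      split_ifs with hn
      · rw [lineShift_X]
      · rw [map_zero, hv n hn, MvPolynomial.C_0, Polynomial.C_0, mul_zero, add_zero]
    simp only [map_mul, Polynomial.map_mul, ha, hXn]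

/-- **An invariant direction supported on the heavy slots stays invariant for the truncation** (ours; THEOREM-F leaves
(a)/(b): "`v` invariant for `g` ⇒ for `trunc g`"). [cite: Lang2002, Ch. IV §1] -/
theorem InvariantDirection.IsInvariantDir.killLight {G : MvPolynomial ι K} {v : ι → K} (h : IsInvariantDir G v)
    (hv : ∀ j, ¬ H j → v j = 0) : IsInvariantDir (killLight H G) v := by
  unfold IsInvariantDir at h ⊢
  rw [lineShift_killLight H v hv, h, Polynomial.map_C, RingHom.coe_coe]

/-- The LIGHT DEGREE `ν` (`0` on heavy, `1` on light slots) of an exponent vector vanishes iff the vector is heavy (ours,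
bookkeeping). [cite: AbramovichTemkinWlodarczyk2024, §5.1 (p. 1575)] -/
theorem weight_lightDegree_eq_zero_iff (t : ι →₀ ℕ) :
    Finsupp.weight (fun j => if H j then (0 : ℤ) else 1) t = 0 ↔ IsHeavy H t := by
  rw [Finsupp.weight_apply, Finsupp.sum, Finset.sum_eq_zero_iff_of_nonneg fun j _ => ?_]
  · refine forall₂_congr fun j hj => ?_
    have htj : t j ≠ 0 := Finsupp.mem_support_iff.mp hj
    by_cases hHj : H j
    · simp [hHj]
    · simp [hHj, htj]
  · refine nsmul_nonneg ?_ _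
    split_ifs <;> decide

/-- **The truncation is the light-degree-`0` component**: `comp_{ν,0} G = killLight H G` (ours). [cite: AbramovichTemkinWlodarczyk2024, §5.1 (p. 1575)] -/
theorem weightedHomogeneousComponent_lightDegree_zero (G : MvPolynomial ι K) :
    MvPolynomial.weightedHomogeneousComponent (fun j => if H j then (0 : ℤ) else 1) 0 G = killLight H G := by
  classical
  refine MvPolynomial.ext _ _ fun t => ?_
  rw [MvPolynomial.coeff_weightedHomogeneousComponent, coeff_killLight]
  by_cases hH : IsHeavy H t
  · rw [if_pos ((weight_lightDegree_eq_zero_iff H t).mpr hH), if_pos hH]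
  · rw [if_neg (fun h => hH ((weight_lightDegree_eq_zero_iff H t).mp h)), if_neg hH]

end KillLight

/-! ## The shift along a class direction is graded -/

section GradedShift

variable {k : Type*} [CommRing k] {ι : Type*} {w : ι → ℚ} {cf : ℚ}

/-- For `v` supported on slots of one weight `cf` and `a` `w`-homogeneous of weight `m`, `a(X + t v)` is homogeneous of total
weight `m` for `deg t = cf`: its `t^s`-coefficient (the `s`-th Hasse derivative along `v`) weighs `m − s·cf` (ours).
[cite: Lang2002, Ch. IV §1] -/
theorem isTW_lineShift {v : ι → k} (hv : ∀ j, v j ≠ 0 → w j = cf) {a : MvPolynomial ι k} {m : ℚ}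
    (ha : MvPolynomial.IsWeightedHomogeneous w a m) : IsTW w cf m (lineShift v a) := by
  classical
  have hlin : ∀ j, IsTW w cf (w j) (C (MvPolynomial.X j) + X * C (MvPolynomial.C (v j)) : (MvPolynomial ι k)[X]) := by
    intro j
    refine (isTW_C (MvPolynomial.isWeightedHomogeneous_X k w j)).add ?_
    by_cases hvj : v j = 0
    · rw [hvj, MvPolynomial.C_0, Polynomial.C_0, mul_zero]; exact isTW_zero _
    · have h := (isTW_X (k := k) (w := w) (ρ := cf)).mul (isTW_C (MvPolynomial.isWeightedHomogeneous_C w (v j)))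
      rw [add_zero] at h
      rw [hv j hvj]
      exact h
  rw [a.as_sum, map_sum]
  refine IsTW.sum _ fun t ht => ?_
  have hwt : ∑ j ∈ t.support, t j • w j = m := by
    rw [← ha (MvPolynomial.mem_support_iff.mp ht), Finsupp.weight_apply, Finsupp.sum]
  rw [lineShift_monomial]
  have hprod : IsTW w cf (∑ j ∈ t.support, t j • w j)
      (∏ j ∈ t.support, (C (MvPolynomial.X j) + X * C (MvPolynomial.C (v j))) ^ t j) :=
    IsTW.prod _ fun j _ => (hlin j).pow (t j)
  have h := (isTW_C (MvPolynomial.isWeightedHomogeneous_C w (a.coeff t))).mul hprod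
  rwa [zero_add, hwt] at h

end GradedShift

/-! ## `Φ(C a) ≡ a(ε + σ u) (mod σ^q)` and the one-parameter rescaling `(lineShift v a)(σΛ)` -/

section Congruence

variable {A : Type*} [CommRing A]

/-- A multiple of `σ^q` has no coefficients below `q` (plumbing). [cite: Matsumura1987, §27 (higher derivations), p. 207] -/
theorem coeff_eq_zero_of_mem_span_X_pow {f : A[X]} {q : ℕ} (hf : f ∈ Ideal.span {(X : A[X]) ^ q}) {s : ℕ} (hs : s < q) :
    f.coeff s = 0 := by
  obtain ⟨r, hr⟩ := Ideal.mem_span_singleton'.mp hf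
  rw [← hr, coeff_mul_X_pow', if_neg (not_le.mpr hs)]

/-- `[σ^s]` of `f(σΛ)` is `Λ^s·[σ^s] f` (plumbing: substituting `t = σΛ` into `a(X + t v)`). [cite: Lang2002, Ch. IV §1] -/
theorem coeff_comp_X_mul_C (f : A[X]) (Λ : A) (s : ℕ) : (f.comp (X * C Λ)).coeff s = Λ ^ s * f.coeff s := by
  induction f using Polynomial.induction_on' with
  | add a b ha hb => rw [add_comp, coeff_add, coeff_add, ha, hb, mul_add]
  | monomial n a =>
    rw [monomial_comp, mul_pow, ← map_pow, mul_comm (X ^ n), ← mul_assoc, ← map_mul, coeff_C_mul_X_pow, coeff_monomial]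
    by_cases h : s = n
    · subst h; rw [if_pos rfl, if_pos rfl, mul_comm]
    · rw [if_neg h, if_neg (Ne.symm h), mul_zero]

variable {k : Type*} [CommRing k] {ι : Type*}

/-- **`Φ(C a) ≡ a(ε + σu) (mod σ^q)`** (ours): if `Φ` fixes the scalars and `Φ(C ε_j) ≡ C ε_j + σ·C u_j (mod σ^q)` for every
slot, then `Φ(C a) ≡ aeval (ε + σ u) a (mod σ^q)` for every `a` — both sides are multiplicative.
[cite: Matsumura1987, §27 (higher derivations), p. 207] -/
theorem sub_aeval_mem_span_X_pow {Φ : (MvPolynomial ι k)[X] →+* (MvPolynomial ι k)[X]}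
    (hC : ∀ c : k, Φ (C (MvPolynomial.C c)) = C (MvPolynomial.C c)) (u : ι → MvPolynomial ι k) (q : ℕ)
    (hX : ∀ j, Φ (C (MvPolynomial.X j)) - (C (MvPolynomial.X j) + X * C (u j)) ∈ Ideal.span {(X : (MvPolynomial ι k)[X]) ^ q})
    (a : MvPolynomial ι k) :
    Φ (C a) - MvPolynomial.aeval (fun j => C (MvPolynomial.X j) + X * C (u j)) a ∈
      Ideal.span {(X : (MvPolynomial ι k)[X]) ^ q} := by
  induction a using MvPolynomial.induction_on with
  | C c =>
    rw [MvPolynomial.aeval_C, Polynomial.algebraMap_apply, MvPolynomial.algebraMap_eq, hC, sub_self]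
    exact zero_mem _
  | add a b ha hb =>
    rw [map_add, map_add, map_add]
    convert add_mem ha hb using 1
    ring
  | mul_X a n ha =>
    rw [map_mul, map_mul, map_mul, MvPolynomial.aeval_X]
    convert add_mem (Ideal.mul_mem_left _ (Φ (C a)) (hX n))
      (Ideal.mul_mem_left _ (C (MvPolynomial.X n) + X * C (u n)) ha) using 1
    ring

/-- Hence below `σ^q` the Taylor coefficients of `Φ` are those of `a(ε + σu)` (ours). [cite: Matsumura1987, §27 (higher derivations), p. 207] -/
theorem coeff_apply_C_eq_coeff_aeval {Φ : (MvPolynomial ι k)[X] →+* (MvPolynomial ι k)[X]}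
    (hC : ∀ c : k, Φ (C (MvPolynomial.C c)) = C (MvPolynomial.C c)) (u : ι → MvPolynomial ι k) (q : ℕ)
    (hX : ∀ j, Φ (C (MvPolynomial.X j)) - (C (MvPolynomial.X j) + X * C (u j)) ∈ Ideal.span {(X : (MvPolynomial ι k)[X]) ^ q})
    (a : MvPolynomial ι k) {s : ℕ} (hs : s < q) :
    (Φ (C a)).coeff s = (MvPolynomial.aeval (fun j => C (MvPolynomial.X j) + X * C (u j)) a).coeff s := by
  have h := coeff_eq_zero_of_mem_span_X_pow (sub_aeval_mem_span_X_pow hC u q hX a) hs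
  rwa [coeff_sub, sub_eq_zero] at h

/-- **Rank-one directions rescale the shift**: `a(ε + σ·Λv) = (a(X + t v))(t := σΛ)` (ours). [cite: Lang2002, Ch. IV §1] -/
theorem aeval_eq_lineShift_comp (v : ι → k) (Λ : MvPolynomial ι k) (a : MvPolynomial ι k) :
    MvPolynomial.aeval (fun j => C (MvPolynomial.X j) + X * C (MvPolynomial.C (v j) * Λ)) a = (lineShift v a).comp (X * C Λ) := by
  induction a using MvPolynomial.induction_on with
  | C c => rw [MvPolynomial.aeval_C, Polynomial.algebraMap_apply, MvPolynomial.algebraMap_eq, lineShift_C, C_comp]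
  | add a b ha hb => rw [map_add, map_add, add_comp, ha, hb]
  | mul_X a n ha =>
    rw [map_mul, map_mul, mul_comp, ha, MvPolynomial.aeval_X, lineShift_X, add_comp, mul_comp, C_comp, X_comp, C_comp,
      mul_assoc, ← map_mul, mul_comm Λ]

end Congruence

/-! ## THEOREM F in LEMMA-XL normal form -/

section TheoremF

variable {k : Type*} [Field k] {ι : Type*} [Fintype ι] [DecidableEq ι] (p : ℕ) [Fact p.Prime] [CharP k p]

omit [Fintype ι] [DecidableEq ι] in
/-- If `Φ` fixes the scalars, `σ` and every slot, it is the identity (plumbing). [cite: Lang2002, Ch. IV §1] -/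
theorem ringHom_eq_id_of_forall_apply_CX {Φ : (MvPolynomial ι k)[X] →+* (MvPolynomial ι k)[X]}
    (hC : ∀ c : k, Φ (C (MvPolynomial.C c)) = C (MvPolynomial.C c)) (hσ : Φ X = X)
    (hX : ∀ j, Φ (C (MvPolynomial.X j)) = C (MvPolynomial.X j)) : Φ = RingHom.id _ := by
  have hconst : Φ.comp C = C :=
    MvPolynomial.ringHom_ext (fun c => by rw [RingHom.comp_apply, hC]) fun j => by rw [RingHom.comp_apply, hX]
  exact Polynomial.ringHom_ext (fun a => by rw [RingHom.id_apply, ← RingHom.comp_apply, hconst]) (by rw [hσ, RingHom.id_apply])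

/-- **THEOREM F★ (T79; THEOREM F of engine 1 in LEMMA-XL normal form, second proof, both leaves).**  `k` perfect of
characteristic `p`; weights `≥ pρ` (`ρ > 0`); `g` `w`-homogeneous of weight `p(p+1)ρ`; `Φ` a graded isotropy of `g` of degree
`ρ` with `Φ ≡ id (mod σ)`, fixing every slot heavier than the `f`-class `(p+1)ρ`, without pure `W`-term on the floor slots, and
with the class-linear pin condition (P) for the truncation `killLight_{(p+1)ρ ≤ w} g` at every `f`-class slot.  Then `Φ = id`.
(derived here — the statement is engine 1's, for its polynomial model; NOT a resolution theorem)
[cite: AbramovichTemkinWlodarczyk2024, Thm. 5.3.1 (2)–(3) (p. 1578)] -/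
theorem IsGradedIso.eq_id_of_classPinned (hperf : ∀ x : k, ∃ y : k, y ^ p = x) {w : ι → ℚ} {ρ : ℚ} (hρ : 0 < ρ)
    (hw : ∀ j, p * ρ ≤ w j) {g : MvPolynomial ι k}
    (hg : MvPolynomial.IsWeightedHomogeneous w g ((p : ℚ) * ((p + 1) * ρ)))
    {Φ : (MvPolynomial ι k)[X] →+* (MvPolynomial ι k)[X]} (hΦ : IsGradedIso w ρ g Φ) (h0 : IsIdModSigma Φ)
    (hV : ∀ j, ((p : ℚ) + 1) * ρ < w j → Φ (C (MvPolynomial.X j)) = C (MvPolynomial.X j))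
    (hW : ∀ n, w n = p * ρ → pureCoeff Φ n p = 0)
    (hP : ∀ i, w i = (p + 1) * ρ →
      ClassPinned (Finset.univ.filter fun j => w j = (p + 1) * ρ) (killLight (fun j => ((p : ℚ) + 1) * ρ ≤ w j) g) i) :
    Φ = RingHom.id _ := by
  -- notation
  have hp : 0 < p := (Fact.out : p.Prime).pos
  have hpq : (0 : ℚ) < p := by exact_mod_cast hp
  have hw' : ∀ j, 0 < w j := fun j => lt_of_lt_of_le (mul_pos hpq hρ) (hw j)
  set Sf : Finset ι := Finset.univ.filter fun j => w j = (p + 1) * ρ with hSf_def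
  set T : Finset ι := Finset.univ.filter fun j => w j = p * ρ with hT_def
  set H : ι → Prop := fun j => ((p : ℚ) + 1) * ρ ≤ w j with hH_def
  set P : MvPolynomial ι k := killLight H g with hP_def
  have hmemSf : ∀ {j}, j ∈ Sf ↔ w j = (p + 1) * ρ := fun {j} => by simp [hSf_def]
  have hmemT : ∀ {j}, j ∈ T ↔ w j = p * ρ := fun {j} => by simp [hT_def]
  have hC : ∀ c : k, Φ (C (MvPolynomial.C c)) = C (MvPolynomial.C c) := hΦ.graded.map_C_C
  -- the Taylor data of the `f`-class slots
  let c : ι → ι → k := fun i n => ((Φ (C (MvPolynomial.X i))).coeff 1).coeff (Finsupp.single n 1)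
  let M : ι → MvPolynomial ι k := fun i => ∑ n ∈ T, MvPolynomial.C (c i n) * MvPolynomial.X n
  let d : ι → k := fun i => pureCoeff Φ i (p + 1)
  -- STEP 2: the shape of `Φ`
  have hfix : ∀ j, j ∉ Sf → Φ (C (MvPolynomial.X j)) = C (MvPolynomial.X j) := by
    intro j hj
    rw [hmemSf] at hj
    rcases lt_or_gt_of_ne hj with hlt | hgt
    · by_cases hjT : w j = p * ρ
      · exact hΦ.graded.apply_CX_eq_of_floor hρ hw (h0 _) hjT (hW j hjT)
      · exact hΦ.graded.apply_CX_eq_of_btwn hρ.le hw (h0 _) (lt_of_le_of_ne (hw j) (Ne.symm hjT)) hlt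
    · exact hV j hgt
  have hface : ∀ i, i ∈ Sf → Φ (C (MvPolynomial.X i)) =
      C (MvPolynomial.X i) + X * C (M i) + C (MvPolynomial.C (d i)) * X ^ (p + 1) := by
    intro i hi
    exact hΦ.graded.apply_CX_eq_of_fclass' hρ hp hw (h0 _) (hmemSf.mp hi)
  have hcoeff1 : ∀ j, (Φ (C (MvPolynomial.X j))).coeff 1 = if j ∈ Sf then M j else 0 := by
    intro j
    split_ifs with hj
    · exact hΦ.graded.coeff_one_eq_sum_of_fclass hρ hp hw (hmemSf.mp hj)
    · rw [hfix j hj, coeff_C, if_neg one_ne_zero]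
  -- `E₁ = Σ_{i ∈ S_f} M_i ∂_i` kills `g`
  let f : ι → MvPolynomial ι k := fun j => if j ∈ Sf then M j else 0
  have hDg : MvPolynomial.mkDerivation k f g = 0 := by
    have hvan : ∀ s, 0 < s → s < 1 → taylorCoeff Φ s = 0 := fun s hs hs1 => absurd hs1 (by omega)
    have h1 := hΦ.lowestDerivation_eq_zero h0 1 one_pos hvan
    rw [derivation_apply_eq_sum_pderiv_mul] at h1
    rw [derivation_apply_eq_sum_pderiv_mul, ← h1]
    refine Finset.sum_congr rfl fun j _ => ?_
    rw [MvPolynomial.mkDerivation_X, lowestDerivation_apply, hcoeff1 j]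
  -- `E₁` has light degree `−1`, so it kills the light-degree-`0` component `P = killLight g`
  have hlightT : ∀ n, n ∈ T → ¬ H n := by
    intro n hn
    rw [hmemT] at hn
    simp only [hH_def, hn, not_le]
    nlinarith
  have hheavySf : ∀ i, i ∈ Sf → H i := by
    intro i hi
    rw [hmemSf] at hi
    simp only [hH_def, hi, le_refl]
  have hgraded : DerivationLayers.IsGradedCoeff (fun j => if H j then (0 : ℤ) else 1) (-1) f := by
    intro j hj
    have hjS : j ∈ Sf := by
      by_contra hjS
      exact hj (if_neg hjS)
    refine ⟨1, ?_, by simp [hheavySf j hjS]⟩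
    rw [show f j = M j from if_pos hjS]
    refine MvPolynomial.IsWeightedHomogeneous.sum T _ _ fun n hn => ?_
    have h := (MvPolynomial.isWeightedHomogeneous_C (fun j => if H j then (0 : ℤ) else 1) (c j n)).mul
      (MvPolynomial.isWeightedHomogeneous_X k (fun j => if H j then (0 : ℤ) else 1) n)
    rwa [zero_add, if_neg (hlightT n hn)] at h
  have hDP : ∑ i ∈ Sf, M i * MvPolynomial.pderiv i P = 0 := by
    have h := DerivationLayers.mkDerivation_component_eq_zero hgraded hDg 1
    rw [show (1 : ℤ) + -1 = 0 by norm_num, weightedHomogeneousComponent_lightDegree_zero, derivation_apply_eq_sum_pderiv_mul] at h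
    rw [← h, ← Finset.sum_subset (Finset.subset_univ Sf) fun j _ hj => by
      rw [MvPolynomial.mkDerivation_X, show f j = 0 from if_neg hj, mul_zero]]
    exact Finset.sum_congr rfl fun j hj => by rw [MvPolynomial.mkDerivation_X, show f j = M j from if_pos hj, mul_comm]
  -- trivial case: no `f`-class slot
  by_cases hSf : Sf = ∅
  · exact ringHom_eq_id_of_forall_apply_CX hC hΦ.map_X fun j => hfix j (by rw [hSf]; exact Finset.notMem_empty j)
  obtain ⟨i₀, hi₀⟩ := Finset.nonempty_iff_ne_empty.mpr hSf
  -- STEP 4 (intrinsic rank one): `c_{in} = v_i λ_n`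
  have hPhom : MvPolynomial.IsWeightedHomogeneous w P ((p : ℚ) * ((p + 1) * ρ)) := hg.killLight H
  have hS : ∀ i ∈ Sf, (p : ℚ) * w i = (p : ℚ) * ((p + 1) * ρ) := fun i hi => by rw [hmemSf.mp hi]
  have hPT : ∀ n ∈ T, n ∉ P.vars := fun n hn => notMem_vars_killLight H g (hlightT n hn)
  obtain ⟨v, lam, hvS, hvl⟩ :=
    exists_rank_one_of_D_eq_zero_class p hperf hw' hPhom Sf hS T hPT c hDP hi₀ (hP i₀ (hmemSf.mp hi₀))
  set Λ : MvPolynomial ι k := ∑ n ∈ T, MvPolynomial.C (lam n) * MvPolynomial.X n with hΛ_def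
  have hMv : ∀ i, i ∈ Sf → M i = MvPolynomial.C (v i) * Λ := by
    intro i hi
    rw [hΛ_def, Finset.mul_sum]
    refine Finset.sum_congr rfl fun n hn => ?_
    rw [show c i n = v i * lam n from hvl i hi n hn, map_mul, mul_assoc]
  have hvH : ∀ j, ¬ H j → v j = 0 := fun j hj => hvS j fun hjS => hj (hheavySf j hjS)
  by_cases hMzero : ∀ i, i ∈ Sf → M i = 0
  · -- LEAF (b): `Φ` is the pure translation `f_i ↦ f_i + σ^{p+1} d_i`, i.e. `expand_{p+1} ∘ lineShift d`
    let dv : ι → k := fun j => if j ∈ Sf then d j else 0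
    have hΦψ : ∀ a, Φ (C a) = expand (MvPolynomial ι k) (p + 1) (lineShift dv a) := by
      intro a
      induction a using MvPolynomial.induction_on with
      | C c' => rw [hC, lineShift_C, expand_C]
      | add a b ha hb => rw [map_add, map_add, map_add, map_add, ha, hb]
      | mul_X a n ha =>
        rw [map_mul, map_mul, map_mul, map_mul, ha, lineShift_X, map_add, map_mul, expand_C, expand_C, expand_X]
        congr 1
        by_cases hn : n ∈ Sf
        · rw [hface n hn, hMzero n hn, map_zero, mul_zero, add_zero, show dv n = d n from if_pos hn, mul_comm]
        · rw [hfix n hn, show dv n = 0 from if_neg hn, MvPolynomial.C_0, Polynomial.C_0, mul_zero, add_zero]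
    have hinv : IsInvariantDir g dv := (isIsotropyOf_iff_of_expand p.succ_pos (fun a => lineShift dv a) hΦψ g).mp hΦ.iso
    by_cases hdv : dv = 0
    · refine ringHom_eq_id_of_forall_apply_CX hC hΦ.map_X fun j => ?_
      by_cases hj : j ∈ Sf
      · have hdj : d j = 0 := by
          have := congrFun hdv j
          rwa [show dv j = d j from if_pos hj] at this
        rw [hface j hj, hMzero j hj, hdj, map_zero, mul_zero, add_zero, MvPolynomial.C_0, Polynomial.C_0, zero_mul, add_zero]
      · exact hfix j hj
    · exfalso
      obtain ⟨i₁, hi₁⟩ : ∃ i₁, dv i₁ ≠ 0 := by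
        by_contra h
        push Not at h
        exact hdv (funext h)
      have hi₁S : i₁ ∈ Sf := by
        by_contra h
        exact hi₁ (if_neg h)
      have hdvS : ∀ j, j ∉ Sf → dv j = 0 := fun j hj => if_neg hj
      exact (hP i₁ (hmemSf.mp hi₁S)).not_isInvariantDir hi₁S hdv hdvS
        (hinv.killLight H fun j hj => hdvS j fun hjS => hj (hheavySf j hjS))
  · -- LEAF (a): `M_{i₁} ≠ 0`, so `Λ ≠ 0`, `v ≠ 0`; `Φ(C a) ≡ (lineShift v a)(σΛ) (mod σ^{p+1})`
    exfalso
    push Not at hMzero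
    obtain ⟨i₁, hi₁S, hMi₁⟩ := hMzero
    have hΛ : Λ ≠ 0 := fun h => hMi₁ (by rw [hMv i₁ hi₁S, h, mul_zero])
    have hvi₁ : v i₁ ≠ 0 := fun h => hMi₁ (by rw [hMv i₁ hi₁S, h, MvPolynomial.C_0, zero_mul])
    have hv0 : v ≠ 0 := fun h => hvi₁ (by rw [h, Pi.zero_apply])
    have hX : ∀ j, Φ (C (MvPolynomial.X j)) - (C (MvPolynomial.X j) + X * C (MvPolynomial.C (v j) * Λ)) ∈
        Ideal.span {(X : (MvPolynomial ι k)[X]) ^ (p + 1)} := by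
      intro j
      by_cases hj : j ∈ Sf
      · rw [hface j hj, hMv j hj, add_sub_cancel_left]
        exact Ideal.mem_span_singleton'.mpr ⟨C (MvPolynomial.C (d j)), rfl⟩
      · rw [hfix j hj, hvS j hj, MvPolynomial.C_0, zero_mul, Polynomial.C_0, mul_zero, add_zero, sub_self]
        exact zero_mem _
    have hcoeff : ∀ s, s < p + 1 → (Φ (C g)).coeff s = Λ ^ s * (lineShift v g).coeff s := by
      intro s hs
      rw [coeff_apply_C_eq_coeff_aeval hC _ (p + 1) hX g hs, aeval_eq_lineShift_comp, coeff_comp_X_mul_C]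
    -- the Hasse derivatives of `g` along `v` vanish: orders `1 ≤ s ≤ p` from `Φ(C g) = C g`, orders `> p` by weight
    have hshift : lineShift v g = C g := by
      refine Polynomial.ext fun s => ?_
      rw [coeff_C]
      split_ifs with hs0
      · subst hs0
        have h := hcoeff 0 p.succ_pos
        rw [pow_zero, one_mul, h0 g] at h
        exact h.symm
      · rcases Nat.lt_or_ge s (p + 1) with hlt | hge
        · have h := hcoeff s hlt
          rw [hΦ.iso, coeff_C, if_neg hs0] at h
          rcases mul_eq_zero.mp h.symm with h1 | h1
          · exact absurd (pow_eq_zero_iff'.mp h1).1 hΛ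
          · exact h1
        · have hvw : ∀ j, v j ≠ 0 → w j = (p + 1) * ρ := fun j hj => hmemSf.mp (by by_contra h; exact hj (hvS j h))
          have hs1 : (p : ℚ) + 1 ≤ s := by exact_mod_cast hge
          have hcf : (0 : ℚ) < ((p : ℚ) + 1) * ρ := by positivity
          have h2 : ((p : ℚ) + 1) * (((p : ℚ) + 1) * ρ) ≤ (s : ℚ) * (((p : ℚ) + 1) * ρ) :=
            mul_le_mul_of_nonneg_right hs1 hcf.le
          have h3 : (0 : ℚ) ≤ p * ρ := mul_nonneg hpq.le hρ.le
          refine (isTW_lineShift hvw hg s).eq_zero_of_weight_lt hw h3 ?_ ?_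
          · rw [nsmul_eq_mul]; linarith
          · rw [nsmul_eq_mul]
            intro h
            have : ((p : ℚ) - s) * ((p + 1) * ρ) = 0 := by linarith
            rcases mul_eq_zero.mp this with h1 | h1
            · have : (p : ℚ) = s := by linarith
              exact absurd (by exact_mod_cast this : p = s) (by omega)
            · exact absurd h1 (mul_pos (by linarith) hρ).ne'
    exact (hP i₁ (hmemSf.mp hi₁S)).not_isInvariantDir hi₁S hv0 hvS ((show IsInvariantDir g v from hshift).killLight H hvH)

end TheoremF

end Literature.AlgebraicGeometry.Resolution.WeightedBlowup
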